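/- Copyright: ym3-torus cell, WIDTH-5 ATTACH seat `ym-ust-19936-w4` (prover, g10), for crux `HistoryTailL` (stmt-QuantumFields-19936),
level-0 prefactor-free infrastructure: the β-UNIFORM Gaussian plaquette tail in Bałaban's `T³` letters, MODULO the one-site doubling.
Released under the licence of the surrounding project. -/
import Summits.QuantumFields.YangMills.Theorems.LocalInsertionExpMomentSU2TorusUniform
import Summits.QuantumFields.YangMills.Theorems.LocalInsertionExpMomentSU2TorusT3
import HarnessLib

/-!
# The β-uniform Gaussian plaquette tail under `gibbsMeasure (F.P K) β` ∕ `gibbsK`, modulo the one-site doubling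

Support file (`--supports stmt-QuantumFields-19936 --as helper`): the `T³` reading (Bałaban's letters `T3Family`, `gibbsMeasure`, `gibbsK`, `dist1`,
`GaugeField.plaqHol`) of the β-UNIFORM tail ✓`ExpMomentSU2Uniform.exists_measureReal_largePlaquette_su2_le_of_oneSiteDoubling` — the twin of
✓`ExpMomentSU2T3.exists_gibbsMeasure_real_dist1_ge_le_T3` (residual `(β∕2)^{3(n²+n+1)∕(2n³)}`, NOT γ-uniform at fixed small `K`) with the residual GONE:

* ★`exists_gibbsMeasure_real_dist1_ge_le_uniform_T3` — `hONE → ∃ A, ∀ F K β, 8 ≤ β → ∀ θ ≥ 0, ∀ p,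
  (gibbsMeasure (F.P K) β).real {U | θ ≤ dist1 U(∂p)} ≤ e^{A} · exp(−(½·(β∕2)·θ²∕2))` (`= e^{A}·e^{−βθ²∕8}`);
* ★`exists_gibbsK_real_dist1_ge_le_uniform` — the same for the tower laws `gibbsK F ℰ γ K` at `β = β_K` (`gibbsK_eq`).

This is GOOD-1's per-plaquette input in γ-UNIFORM form (LEAD ★w1-19936 g7 00:52:13Z), CONDITIONAL on the displayed d = 3 one-site doubling
`hONE : ∃ K, ∀ t > 0, Z₁(t∕4) ≤ K·Z₁(t)` (`Z₁ = partitionFunction (d := 3) (L := 1) (fundamentalRep (Fin 2))`; T4-ONE, NOT proved in the tree) and on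
nothing else (bridge ✓`T3FinestHeightTail.gibbsMeasure_real_eq_wilsonMeasure_real`, coupling `β∕2`, lattice symmetry ✓`integral_plaquette_eq_of_symmetry`).

HONEST SCOPE.  Dictionary work over tree theorems; nothing of (T4-ONE), of the lines' stubs, of `HistoryTailL` or of any crux is proved.  YM₃ on T³ is
rung R3 — not d = 4, not infinite volume, not a mass gap, not Clay.
-/

namespace Summit.QuantumFields.YangMills.Theorems.LocalInsertion.ExpMomentSU2UniformT3

open MeasureTheory Real
open scoped Matrix.Norms.L2Operator ENNReal
open Literature.MathematicalPhysics.QuantumFieldTheory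
open Literature.MathematicalPhysics.QuantumFieldTheory.Balaban1983to89
open Literature.MathematicalPhysics.QuantumFieldTheory.Balaban1983to89.T3ContinuumYM3Torus
open Literature.MathematicalPhysics.QuantumFieldTheory.Balaban1983to89.T3UnitScaleTilt
open Literature.MathematicalPhysics.QuantumLattice (fundamentalRep fundamentalRep_apply continuous_fundamentalRep)
open Summit.QuantumFields.YangMills.Theorems.LocalInsertion.ExpMomentSU2T3 (one_lt_sitesPerDir)
open Summit.QuantumFields.YangMills.Theorems.LocalInsertion.ExpMomentSU2Uniform
  (exists_measureReal_largePlaquette_su2_le_of_oneSiteDoubling)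

noncomputable section

/-- ★ **THE β-UNIFORM GAUSSIAN PLAQUETTE TAIL UNDER `gibbsMeasure (F.P K) β`, MODULO THE ONE-SITE DOUBLING**: if `Z₁(t∕4) ≤ K·Z₁(t)` for all
`t > 0` (d = 3 one-site doubling for `SU(2)`), there is `A` with, for every `T3Family F`, cut-off `K`, coupling `β ≥ 8`, `θ ≥ 0` and plaquette `p` of
`T^{(0)}_K`:  `(gibbsMeasure (F.P K) β).real {U | θ ≤ dist1 (U(∂p))} ≤ e^{A} · exp(−(½·(β∕2)·θ²∕2))` — no power of `β`, no power of the volume.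
[cite: Chatterjee2016, Thm. 2.1; FrohlichIsraelLiebSimon1978, Thm. 4.1; Balaban1985UV3, (11) p.258] -/
theorem exists_gibbsMeasure_real_dist1_ge_le_uniform_T3
    (hONE : ∃ K : ℝ, ∀ t : ℝ, 0 < t →
      (partitionFunction (d := 3) (L := 1) (fundamentalRep (Fin 2)) (t / 4)).toReal ≤
        K * (partitionFunction (d := 3) (L := 1) (fundamentalRep (Fin 2)) t).toReal) :
    ∃ A : ℝ, ∀ (F : T3Family) (K : ℕ) (β : ℝ), 8 ≤ β → ∀ (θ : ℝ), 0 ≤ θ → ∀ p : Plaq (F.P K) 0,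
      (T4GenFunBounds.gibbsMeasure (F.P K) β).real
          {U : GaugeField (F.P K) 0 (Matrix.specialUnitaryGroup (Fin 2) ℂ) | θ ≤ dist1 (GaugeField.plaqHol U p)} ≤
        Real.exp A * Real.exp (-(1 / 2 * (β / 2) * θ ^ 2 / 2)) := by
  obtain ⟨A, hGT⟩ := exists_measureReal_largePlaquette_su2_le_of_oneSiteDoubling hONE
  refine ⟨A, fun F K β hβ θ hθ p => ?_⟩
  set ρ := fundamentalRep (Fin 2) with hρdef
  have hρc : Continuous ρ := continuous_fundamentalRep (Fin 2)
  have hβ0 : 0 < β := by linarith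
  -- the event and its measurability on both carriers
  set E : Set (Matrix.specialUnitaryGroup (Fin 2) ℂ) := {g | θ ≤ dist1 g} with hE
  have hEm : MeasurableSet E := measurableSet_le measurable_const RegularGaugeGroup.measurable_dist1
  have hSm : MeasurableSet {U : GaugeField (F.P K) 0 (Matrix.specialUnitaryGroup (Fin 2) ℂ) | θ ≤ dist1 (GaugeField.plaqHol U p)} :=
    measurableSet_le measurable_const (RegularGaugeGroup.measurable_dist1.comp (Missing.measurable_plaqHol p))
  -- the dictionary: Bałaban's Gibbs measure at `β` = the host Wilson measure at `β ∕ 2`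
  set x : Literature.MathematicalPhysics.QuantumFieldTheory.Site (F.P K).d ((F.P K).sitesPerDir 0) := p.src with hx
  have hpre : (ofConfig (P := F.P K) (j := 0)) ⁻¹'
        {U : GaugeField (F.P K) 0 (Matrix.specialUnitaryGroup (Fin 2) ℂ) | θ ≤ dist1 (GaugeField.plaqHol U p)} =
      {V : GaugeConfig (F.P K).d ((F.P K).sitesPerDir 0) (Matrix.specialUnitaryGroup (Fin 2) ℂ) |
        plaquetteHolonomy V x p.μ p.ν ∈ E} := by
    ext V
    simp only [Set.mem_preimage, Set.mem_setOf_eq, hE, hx]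
    rw [← plaquetteHolonomy_toConfig (ofConfig V) p, toConfig_ofConfig]
  rw [T3FinestHeightTail.gibbsMeasure_real_eq_wilsonMeasure_real (F.P K) (N := 2) hβ0.le hSm, hpre]
  have hN : β / ((2 : ℕ) : ℝ) = β / 2 := by norm_num
  rw [hN]
  -- lattice symmetry: the plaquette `(x; μ, ν)` has the law of `(x; 0, ν)`
  haveI : Fact (1 < (F.P K).sitesPerDir 0) := ⟨one_lt_sitesPerDir F K⟩
  haveI := isProbabilityMeasure_wilsonMeasure (d := (F.P K).d) (L := (F.P K).sitesPerDir 0) ρ hρc (β / 2)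
  have hν0 : p.ν ≠ 0 := fun h => by
    have := p.hμν; rw [h] at this; exact (Fin.not_lt_zero _ this).elim
  have hν0' : (0 : Fin (F.P K).d) < p.ν := Fin.pos_iff_ne_zero.2 hν0
  have hreal : ∀ {q q' : Fin (F.P K).d}, (wilsonMeasure (d := (F.P K).d) (L := (F.P K).sitesPerDir 0) ρ (β / 2)).real
        {V : GaugeConfig (F.P K).d ((F.P K).sitesPerDir 0) (Matrix.specialUnitaryGroup (Fin 2) ℂ) |
          plaquetteHolonomy V x q q' ∈ E} =
      ∫ V, E.indicator (fun _ => (1 : ℝ)) (plaquetteHolonomy V x q q')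
        ∂(wilsonMeasure (d := (F.P K).d) (L := (F.P K).sitesPerDir 0) ρ (β / 2)) := by
    intro q q'
    have hset : {V : GaugeConfig (F.P K).d ((F.P K).sitesPerDir 0) (Matrix.specialUnitaryGroup (Fin 2) ℂ) |
          plaquetteHolonomy V x q q' ∈ E} =
        (fun V : GaugeConfig (F.P K).d ((F.P K).sitesPerDir 0) (Matrix.specialUnitaryGroup (Fin 2) ℂ) =>
          plaquetteHolonomy V x q q') ⁻¹' E := rfl
    rw [hset, ← integral_indicator_one ((measurable_plaquetteHolonomy x q q') hEm)]
    refine integral_congr_ae (Filter.Eventually.of_forall fun V => ?_)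
    show ((fun W : GaugeConfig (F.P K).d ((F.P K).sitesPerDir 0) (Matrix.specialUnitaryGroup (Fin 2) ℂ) =>
        plaquetteHolonomy W x q q') ⁻¹' E).indicator (fun _ => (1 : ℝ)) V =
      E.indicator (fun _ => (1 : ℝ)) (plaquetteHolonomy V x q q')
    by_cases hV : plaquetteHolonomy V x q q' ∈ E
    · rw [Set.indicator_of_mem hV, Set.indicator_of_mem
        (show V ∈ (fun W : GaugeConfig (F.P K).d ((F.P K).sitesPerDir 0) (Matrix.specialUnitaryGroup (Fin 2) ℂ) =>
          plaquetteHolonomy W x q q') ⁻¹' E from hV)]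
    · rw [Set.indicator_of_notMem hV, Set.indicator_of_notMem
        (show V ∉ (fun W : GaugeConfig (F.P K).d ((F.P K).sitesPerDir 0) (Matrix.specialUnitaryGroup (Fin 2) ℂ) =>
          plaquetteHolonomy W x q q') ⁻¹' E from hV)]
  rw [hreal, FariaDaVeigaOCarroll2022.integral_plaquette_eq_of_symmetry ρ hρc (β / 2) (fun g => E.indicator (fun _ => (1 : ℝ)) g)
    x x (ne_of_lt p.hμν) hν0, ← hreal]
  -- the prefactor-free tail of the reference orientation (`GaugeConfig 3 n`, `P.d = 3` definitionally)
  have hev : {V : GaugeConfig (F.P K).d ((F.P K).sitesPerDir 0) (Matrix.specialUnitaryGroup (Fin 2) ℂ) |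
        plaquetteHolonomy V x 0 p.ν ∈ E} =
      {V : GaugeConfig 3 ((F.P K).sitesPerDir 0) (Matrix.specialUnitaryGroup (Fin 2) ℂ) |
        θ ≤ ‖(fundamentalRep (Fin 2)) (plaquetteHolonomy V x 0 p.ν) - 1‖} := by
    ext V; rfl
  rw [hev]
  have hn2 : 2 ≤ (F.P K).sitesPerDir 0 := one_lt_sitesPerDir F K
  exact hGT ((F.P K).sitesPerDir 0) (β / 2) hn2 (even_sitesPerDir (F.P K) 0) (by linarith) hν0' x hθ

/-- ★★ **THE SAME FOR THE TOWER LAWS `gibbsK`** (`β := β_K = (F.scheme ℰ γ).β K`, `gibbsK_eq`): `hONE → ∃ A, ∀ F ℰ γ K, 8 ≤ β_K → ∀ θ ≥ 0, ∀ p,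
(gibbsK F ℰ γ K).real {U | θ ≤ dist1 U(∂p)} ≤ e^{A} · exp(−(½·(β_K∕2)·θ²∕2))` — GOOD-1's per-plaquette input, γ-uniform, modulo (T4-ONE).
[cite: Chatterjee2016, Thm. 2.1; Balaban1985UV3, (7) p.257 and (71) p.273] -/
theorem exists_gibbsK_real_dist1_ge_le_uniform
    (hONE : ∃ K : ℝ, ∀ t : ℝ, 0 < t →
      (partitionFunction (d := 3) (L := 1) (fundamentalRep (Fin 2)) (t / 4)).toReal ≤
        K * (partitionFunction (d := 3) (L := 1) (fundamentalRep (Fin 2)) t).toReal) :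
    ∃ A : ℝ, ∀ (F : T3Family) (ℰ : LoopAverage (Matrix.specialUnitaryGroup (Fin 2) ℂ)) (γ : ℝ) (K : ℕ),
      8 ≤ (F.scheme ℰ γ).β K → ∀ (θ : ℝ), 0 ≤ θ → ∀ p : Plaq (F.P K) 0,
        (gibbsK F ℰ γ K).real
            {U : GaugeField (F.P K) 0 (Matrix.specialUnitaryGroup (Fin 2) ℂ) | θ ≤ dist1 (GaugeField.plaqHol U p)} ≤
          Real.exp A * Real.exp (-(1 / 2 * ((F.scheme ℰ γ).β K / 2) * θ ^ 2 / 2)) := by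
  obtain ⟨A, h⟩ := exists_gibbsMeasure_real_dist1_ge_le_uniform_T3 hONE
  refine ⟨A, fun F ℰ γ K hβ θ hθ p => ?_⟩
  rw [gibbsK_eq]
  exact h F K ((F.scheme ℰ γ).β K) hβ θ hθ p

/-! ### (EQ1), γ-uniform: the mean plaquette deviation is `O(1∕√β)` -/

/-- **Layer-cake against a Gaussian tail**: if `f ≥ 0` has `μ{θ < f} ≤ M·e^{−cθ²}` for all `θ > 0` (`M ≥ 0`, `c > 0`), then
`∫ f dμ ≤ M·√(π∕c)∕2` (Cavalieri ✓`Integrable.integral_eq_integral_meas_lt` and ✓`integral_gaussian_Ioi`; a non-integrable `f` has integral `0`). [folklore] -/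
theorem integral_le_of_gaussian_tail {Ω : Type*} [MeasurableSpace Ω] {μ : Measure Ω} {f : Ω → ℝ} (hf0 : ∀ ω, 0 ≤ f ω)
    {M c : ℝ} (hM : 0 ≤ M) (hc : 0 < c) (htail : ∀ θ : ℝ, 0 < θ → μ.real {ω | θ < f ω} ≤ M * Real.exp (-c * θ ^ 2)) :
    ∫ ω, f ω ∂μ ≤ M * (Real.sqrt (Real.pi / c) / 2) := by
  have hbound : 0 ≤ M * (Real.sqrt (Real.pi / c) / 2) := by positivity
  by_cases hfi : Integrable f μ
  · rw [hfi.integral_eq_integral_meas_lt (ae_of_all _ hf0)]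
    have hgi : IntegrableOn (fun t : ℝ => M * Real.exp (-c * t ^ 2)) (Set.Ioi 0) :=
      ((integrable_exp_neg_mul_sq hc).const_mul M).integrableOn
    calc ∫ t in Set.Ioi 0, μ.real {a | t < f a} ≤ ∫ t in Set.Ioi 0, M * Real.exp (-c * t ^ 2) := by
          refine integral_mono_of_nonneg (ae_of_all _ fun t => measureReal_nonneg) hgi ?_
          exact (ae_restrict_iff' measurableSet_Ioi).2 (ae_of_all _ fun t (ht : 0 < t) => htail t ht)
      _ = M * (Real.sqrt (Real.pi / c) / 2) := by rw [integral_const_mul, integral_gaussian_Ioi]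
  · rw [integral_undef hfi]; exact hbound

/-- ★ **(EQ1), β-UNIFORM, MODULO THE ONE-SITE DOUBLING**: `hONE → ∃ C, ∀ F K β, 8 ≤ β → ∀ p : Plaq (F.P K) 0,
∫ dist1 (U(∂p)) d(gibbsMeasure (F.P K) β) ≤ C ∕ √β` — the mean plaquette deviation at the true Gaussian scale `β^{−1∕2}`, with NO residual power
(`C = e^{A}·√(8π)∕2`, from the tail `exists_gibbsMeasure_real_dist1_ge_le_uniform_T3` by `integral_le_of_gaussian_tail` at `c = β∕8`).
[cite: Chatterjee2016, Thm. 2.1; Balaban1985UV3, (11) p.258] -/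
theorem exists_integral_dist1_le_uniform_T3
    (hONE : ∃ K : ℝ, ∀ t : ℝ, 0 < t →
      (partitionFunction (d := 3) (L := 1) (fundamentalRep (Fin 2)) (t / 4)).toReal ≤
        K * (partitionFunction (d := 3) (L := 1) (fundamentalRep (Fin 2)) t).toReal) :
    ∃ C : ℝ, ∀ (F : T3Family) (K : ℕ) (β : ℝ), 8 ≤ β → ∀ p : Plaq (F.P K) 0,
      ∫ U : GaugeField (F.P K) 0 (Matrix.specialUnitaryGroup (Fin 2) ℂ), dist1 (GaugeField.plaqHol U p)
        ∂(T4GenFunBounds.gibbsMeasure (F.P K) β) ≤ C / Real.sqrt β := by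
  obtain ⟨A, hGT⟩ := exists_gibbsMeasure_real_dist1_ge_le_uniform_T3 hONE
  refine ⟨Real.exp A * Real.sqrt (8 * Real.pi) / 2, fun F K β hβ p => ?_⟩
  haveI := T4GenFunBounds.isProbabilityMeasure_gibbsMeasure (G := Matrix.specialUnitaryGroup (Fin 2) ℂ) (F.P K)
    (show (0 : ℝ) ≤ β by linarith)
  have hβ0 : 0 < β := by linarith
  have hc : 0 < β / 8 := by positivity
  have htail : ∀ θ : ℝ, 0 < θ → (T4GenFunBounds.gibbsMeasure (F.P K) β).real
      {U : GaugeField (F.P K) 0 (Matrix.specialUnitaryGroup (Fin 2) ℂ) | θ < dist1 (GaugeField.plaqHol U p)} ≤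
        Real.exp A * Real.exp (-(β / 8) * θ ^ 2) := by
    intro θ hθ
    have hsub : {U : GaugeField (F.P K) 0 (Matrix.specialUnitaryGroup (Fin 2) ℂ) | θ < dist1 (GaugeField.plaqHol U p)} ⊆
        {U | θ ≤ dist1 (GaugeField.plaqHol U p)} := fun U hU => le_of_lt (α := ℝ) hU
    refine (measureReal_mono hsub).trans ?_
    have h := hGT F K β hβ θ hθ.le p
    rwa [show -(1 / 2 * (β / 2) * θ ^ 2 / 2) = -(β / 8) * θ ^ 2 by ring] at h
  refine (integral_le_of_gaussian_tail (fun U => GaugeGroup.dist1_nonneg _) (Real.exp_pos A).le hc htail).trans (le_of_eq ?_)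
  rw [show Real.pi / (β / 8) = 8 * Real.pi / β by field_simp, Real.sqrt_div (by positivity) β]
  ring

/-- ★★ **(EQ1) FOR THE TOWER LAWS `gibbsK`, β-UNIFORM, MODULO THE ONE-SITE DOUBLING**: `hONE → ∃ C, ∀ F ℰ γ K, 8 ≤ β_K → ∀ p,
∫ dist1 (U(∂p)) d(gibbsK F ℰ γ K) ≤ C ∕ √β_K`. [cite: Chatterjee2016, Thm. 2.1; Balaban1985UV3, (7) p.257] -/
theorem exists_integral_dist1_gibbsK_le_uniform
    (hONE : ∃ K : ℝ, ∀ t : ℝ, 0 < t →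
      (partitionFunction (d := 3) (L := 1) (fundamentalRep (Fin 2)) (t / 4)).toReal ≤
        K * (partitionFunction (d := 3) (L := 1) (fundamentalRep (Fin 2)) t).toReal) :
    ∃ C : ℝ, ∀ (F : T3Family) (ℰ : LoopAverage (Matrix.specialUnitaryGroup (Fin 2) ℂ)) (γ : ℝ) (K : ℕ),
      8 ≤ (F.scheme ℰ γ).β K → ∀ p : Plaq (F.P K) 0,
        ∫ U, dist1 (GaugeField.plaqHol U p) ∂(gibbsK F ℰ γ K) ≤ C / Real.sqrt ((F.scheme ℰ γ).β K) := by
  obtain ⟨C, h⟩ := exists_integral_dist1_le_uniform_T3 hONE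
  refine ⟨C, fun F ℰ γ K hβ p => ?_⟩
  rw [gibbsK_eq]
  exact h F K ((F.scheme ℰ γ).β K) hβ p

end

end Summit.QuantumFields.YangMills.Theorems.LocalInsertion.ExpMomentSU2UniformT3
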